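import Summits.BirchSwinnertonDyer.BirchSwinnertonDyer.Theorems.ErratumRoadFiveIMCDivClassicalBGuardedAtomFromThm124bTransfer
import Summits.BirchSwinnertonDyer.BirchSwinnertonDyer.Theorems.ErratumRoadFiveIMCDivClassicalBGuardedOpenInput
import Summits.BirchSwinnertonDyer.BirchSwinnertonDyer.Theorems.ErratumRoadFiveIMCDivClassicalBLambdaMatchingFromFacts
import HarnessLib

/-!
# Route `ErratumRoadFive` (K2, `p ≥ 5`), the END-STATE class record's main-conjecture half (T1′)
# `Typed.MissingLowerBoundAt W p` AT ONE PAIR, RESOLVED INTO ROAD B12's SOURCES — PART 5 of the guarded road: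
# {Hsieh 2014 Thm 5.6 + BDP13 Thm 5.5 (FRAME), BCS25 Thm 1.2.4 (b) + Prop 4.2.2, the JIMJ18 display, route p2's
# published facts, Hoffstein–Luo} + the two OPEN shapes UB♯|ᵍ and TRANSFER|ᵍ at the pair

Cell `bsd-stepL` (run/shared/lean/pub/bsd-stepL/), seat `bsd-stepL-bdp` (prover g24, 2026-08-27). `--supports
stmt-BirchSwinnertonDyer-19282 --as helper`. THEOREMS ONLY (no definition, no named fact, no `sorry`). Memo:
HOME/proof/PROOF-BDP.md §60 (60.3, 60.9).

WHAT. `P2.bsdp_of_onTree_endState_of_lowerHalf` (multr1-p2 gen 27, `X11b/BDPRouteOpenInputFieldEndState.lean`)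
consumes, per surjective X11b pair at `p ≥ 5`, the numerical lower half (T1′) `Typed.MissingLowerBoundAt W p`
(`ord_p #Ш(E)_an ≤ ord_p #Ш(E)`). This file supplies it AT ONE PAIR from ROAD B12 with the guard `d_K ≠ −3`:
FRAME by p512577 (`P2.unrFrame_of_hsieh2014_unrPeriod_of_bdp2013`), the guarded atom display by PART 2 (p561501),
the guarded open input and the Hoffstein–Luo field by PART 3 (p561251, §5–§8). On the ¬ram rows (item 19282, whose
∀K B-stub is NOT reachable at `K = ℚ(√−3)`, PROOF-BDP 57.12 ∕ 60.3) this is the honest END FORM of the road; on the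
(ram) rows PART 4 (p563393) goes further (items 19702 ∕ 19703 by name, by tightness).

* `Rest3GuardedB12.missingLowerBoundAt_of_thm124b_of_upperDivisibility_of_transfer` — `Typed.MissingLowerBoundAt W p`
  for `(W, p)` with `ClassX11b W p`, `5 ≤ p`, `Surj W p`, from the named facts + UB♯|ᵍ(W, p) + TRANSFER|ᵍ(W, p).

HONEST FRAMING: CONDITIONAL theorem at ONE pair; UB♯|ᵍ (PROOF-BDP §55, refereed) and TRANSFER|ᵍ (§40 ∕ §37.11 ∕
§58) are OPEN typed shapes; TRANSFER is suppliable only on the finite-flat locus `p ∣ v_p(Δ_min)` (a good partner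
exists there and only there: 40 799 class-wide pairs at `p ≥ 5`, 908 of them ¬ram; 57.2) — a class-wide
`∀ W p` version of the hypothesis would be unsatisfiable and is deliberately NOT stated; the named facts are carried
by name (flag D1 on Thm 1.2.4); nothing is discharged, booked or re-labelled (T7); BSD is proved for no pair.

References: [Hsieh2014] Thm. 5.6; [BertoliniDarmonPrasanna2013] Thm. 5.5; arXiv:2405.00270v2 Thm. 1.2.4 (b),
Prop. 4.2.2; [Castella2018] Thms. 2.3, 3.1, 3.2, §5; [Castella2018Exceptional] Thms. 2.10–2.11; [Castella2018Erratum]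
(2.4); [HoffsteinLuo1997]; PROOF-BDP §57, §60.
-/

set_option autoImplicit false
set_option linter.dupNamespace false

noncomputable section

open scoped Classical NumberField Topology

open Filter WeierstrassCurve NumberField IsDedekindDomain Field PowerSeries
open Literature.NumberTheory.EllipticCurves Literature.NumberTheory.EllipticCurves.GreenbergSelmer
open Literature.NumberTheory.EllipticCurves.ModularForms
open Literature.NumberTheory.EllipticCurves.Rank1Residual
open Literature.NumberTheory.EllipticCurves.Rank1Residual.Typed
open Literature.NumberTheory.EllipticCurves.Castella2018
open Literature.NumberTheory.EllipticCurves.Castella2018Exceptional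
open Literature.NumberTheory.EllipticCurves.Wuthrich2014
open Literature.NumberTheory.GaloisRepresentations Literature.NumberTheory.GaloisCohomology
open Literature.NumberTheory.Automorphic
open Summit.BirchSwinnertonDyer.Rank1Residual Summit.BirchSwinnertonDyer.Rank1Residual.X11b
open Summit.BirchSwinnertonDyer.Rank1Residual.X11b.AcSelmer
open Summit.BirchSwinnertonDyer.Rank1Residual.X11b.Halves
open Summit.BirchSwinnertonDyer.BirchSwinnertonDyer.Theorems.Rest3TorsionBranchB

namespace Summit.BirchSwinnertonDyer.BirchSwinnertonDyer.Theorems.Rest3GuardedB12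

variable {W : WeierstrassCurve ℚ} [W.IsElliptic] [W.IsGloballyMinimal] {p : ℕ} [Fact p.Prime]

/-- **(T1′) AT ONE PAIR FROM ROAD B12 (guarded): `Typed.MissingLowerBoundAt W p` ⟸ {Hsieh 2014 Thm 5.6, BDP13
Thm 5.5, BCS25 Thm 1.2.4 (b), BCS25 Prop 4.2.2, the JIMJ18 display, route p2's published facts, Hoffstein–Luo}
+ UB♯|ᵍ(W, p) + TRANSFER|ᵍ(W, p).** Composition: FRAME (p512577) → guarded atom display (PART 2 §4) → guarded
H∃♭ᴮ and open input (PART 3 §5–§6) → `P2.OpenInputOnTreeAtField` at a Hoffstein–Luo field with `|d_K| > 4`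
(PART 3 §7–§8) → multr1-p2 gen 27's `P2.missingLowerBoundAt_of_openInputAtField`. CONDITIONAL; nothing booked.
[cite: Hsieh2014, Thm. 5.6 (arXiv:1112.1580 p. 23)] [cite: BertoliniDarmonPrasanna2013, Thm. 5.5 and (5.1.16)]
[cite: BurungaleCastellaSkinner2025, Thm. 1.2.4 (b) and Prop. 4.2.2 (arXiv:2405.00270v2 pp. 3, 8–9)]
[cite: Castella2018Exceptional, Thms. 2.10–2.11 (arXiv:1507.04260 pp. 13–14)]
[cite: Castella2018, Thms. 2.3, 3.1, 3.2, §5 (arXiv:1704.06608 pp. 5, 9, 12)] [cite: HoffsteinLuo1997, Theorem] -/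
theorem missingLowerBoundAt_of_thm124b_of_upperDivisibility_of_transfer
    (hH : hsieh2014_exists_anticyclotomicPAdicLFunction_unrPeriod)
    (hR : bertoliniDarmonPrasanna2013_centralValue_reciprocity)
    (h124 : BurungaleCastellaSkinner2025.thm124b_exists_isBDPLFunction_isTorsion_charIdeal_eq)
    (h422 : BurungaleCastellaSkinner2025.prop422_exists_isBDPLFunction_mu_eq_zero)
    (hGZ : ∀ (N : ℕ) [NeZero N] (W : WeierstrassCurve ℚ) (K : Type) [Field K] [NumberField K],
      gross_zagier N W K)
    (hKo : ∀ (N : ℕ) [NeZero N] (W : WeierstrassCurve ℚ) (K : Type) [Field K] [NumberField K],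
      kolyvagin N W K)
    (hWu : sha_dvd_analyticSha)
    (hGZK : rank_eq_analyticRank_of_analyticRank_le_one) (hmod : hasEntireLFunction_rat)
    (hnf : exists_isNewformOf) (hMaz : mazur_not_dvd_maninConstant_of_odd)
    (hHL : HoffsteinLuo1997_exists_twist_L_one_ne_zero)
    (hPT : ∀ (K : Type) [Field K] [NumberField K], poitouTate_sum_localTatePairing_eq_zero K)
    (hEP : ∀ (K : Type) [Field K] [NumberField K] (v : HeightOneSpectrum (𝓞 K)),
      localEulerPoincareCharacteristic (v.adicCompletion K))
    (hB : thm210_thm211_bdpDisplay_pNew)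
    (hUB : ∀ (N : ℕ) [NeZero N] (K : Type) [Field K] [NumberField K]
      (Dt : ModularParametrizationData W N) (H : HeegnerDatum N (NumberField.discr K)) (ι : K →+* ℂ)
      (P : (W.baseChange K).toAffine.Point),
      ClassX11b W p → 5 ≤ p → Surj W p → W.conductorNorm ℤ = N → IsImaginaryQuadratic K →
      Odd (NumberField.discr K) → NumberField.discr K ≠ -3 → ¬ (p : ℤ) ∣ NumberField.discr K →
      ¬ p ∣ Units.torsionOrder K → SatisfiesHeegnerHypothesis N K →
      (W.quadraticTwist (NumberField.discr K : ℚ)).entireLFunction 1 ≠ 0 →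
      WeierstrassCurve.Affine.Point.map ι.toRatAlgHom P = heegnerPointComplex Dt H →
      ¬ (p : ℤ) ∣ Dt.c → ¬ IsOfFinAddOrder P →
      ∀ (κ : ZpExtension K p), κ.IsAnticyclotomic →
        ∀ (γ : Field.absoluteGaloisGroup K) [Fact (κ.IsTopGenerator γ)]
          (ι' : PadicAlgCl p ≃+* ℂ) (w₀ : InfinitePlace K) (P' : (W.baseChange K).toAffine.Point),
          WeierstrassCurve.Affine.Point.map w₀.embedding.toRatAlgHom P' = heegnerPointComplex Dt H →
          ∀ (e : K →+* ℚ_[p]),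
            (∀ k : 𝓞 K, k ∈ (primeOfEmbeddingDatum p ι' w₀.embedding).asIdeal ↔ ‖e (k : K)‖ < 1) →
            ∀ (ΩK : ℂ) (Ωp : (unrIntegers p)ˣ) (L : UnrSeries p), ΩK ≠ 0 →
              IsBDPLFunction ι' (primeOfEmbeddingDatum p ι' w₀.embedding) κ γ Dt.f ΩK
                ((Ωp : unrIntegers p) : ℂ_[p]) L →
              ∀ (𝔭bar : HeightOneSpectrum (𝓞 K)), ((p : ℕ) : 𝓞 K) ∈ 𝔭bar.asIdeal →
                𝔭bar ≠ primeOfEmbeddingDatum p ι' w₀.embedding →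
                L ∈ (XAc.charIdeal (W.baseChange K) p κ 𝔭bar ∅ γ).map (PowerSeries.map (toUnr p)))
    (hTR : ∀ (N : ℕ) [NeZero N] (K : Type) [Field K] [NumberField K]
      (Dt : ModularParametrizationData W N) (H : HeegnerDatum N (NumberField.discr K)) (ι : K →+* ℂ)
      (P : (W.baseChange K).toAffine.Point),
      ClassX11b W p → 5 ≤ p → Surj W p → W.conductorNorm ℤ = N → IsImaginaryQuadratic K →
      Odd (NumberField.discr K) → NumberField.discr K ≠ -3 → ¬ (p : ℤ) ∣ NumberField.discr K →
      ¬ p ∣ Units.torsionOrder K → SatisfiesHeegnerHypothesis N K →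
      (W.quadraticTwist (NumberField.discr K : ℚ)).entireLFunction 1 ≠ 0 →
      WeierstrassCurve.Affine.Point.map ι.toRatAlgHom P = heegnerPointComplex Dt H →
      ¬ (p : ℤ) ∣ Dt.c → ¬ IsOfFinAddOrder P →
      ∀ (κ : ZpExtension K p), κ.IsAnticyclotomic →
        ∀ (γ : Field.absoluteGaloisGroup K) [Fact (κ.IsTopGenerator γ)]
          (ι' : PadicAlgCl p ≃+* ℂ) (w₀ : InfinitePlace K) (P' : (W.baseChange K).toAffine.Point),
          WeierstrassCurve.Affine.Point.map w₀.embedding.toRatAlgHom P' = heegnerPointComplex Dt H →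
          ∀ (e : K →+* ℚ_[p]),
            (∀ k : 𝓞 K, k ∈ (primeOfEmbeddingDatum p ι' w₀.embedding).asIdeal ↔ ‖e (k : K)‖ < 1) →
            ∀ (ΩK : ℂ) (Ωp : (unrIntegers p)ˣ) (L : UnrSeries p), ΩK ≠ 0 →
              IsBDPLFunction ι' (primeOfEmbeddingDatum p ι' w₀.embedding) κ γ Dt.f ΩK
                ((Ωp : unrIntegers p) : ℂ_[p]) L →
              ∀ (𝔭bar : HeightOneSpectrum (𝓞 K)), ((p : ℕ) : 𝓞 K) ∈ 𝔭bar.asIdeal →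
                𝔭bar ≠ primeOfEmbeddingDatum p ι' w₀.embedding →
                ∃ (W' : WeierstrassCurve ℚ) (_ : W'.IsElliptic) (_ : W'.IsGloballyMinimal) (N' : ℕ)
                  (_ : NeZero N') (Dt' : ModularParametrizationData W' N'),
                  GoodOrd W' p ∧ Surj W' p ∧ SatisfiesHeegnerHypothesis N' K ∧
                  ∀ (g g' : IwasawaAlgebra p),
                    XAc.charIdeal (W.baseChange K) p κ 𝔭bar ∅ γ = Ideal.span {g} →
                    XAc.charIdeal (W'.baseChange K) p κ 𝔭bar ∅ γ = Ideal.span {g'} →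
                    ∀ (ΩK' : ℂ) (Ωp' : (unrIntegers p)ˣ) (L' : UnrSeries p), ΩK' ≠ 0 →
                      IsBDPLFunction ι' (primeOfEmbeddingDatum p ι' w₀.embedding) κ γ Dt'.f ΩK'
                        ((Ωp' : unrIntegers p) : ℂ_[p]) L' →
                      ∃ (P P' u : UnrSeries p) (m m' : ℕ),
                        (‖((coeff m P : unrIntegers p) : ℂ_[p])‖ = 1 ∧
                          ∀ i < m, ‖((coeff i P : unrIntegers p) : ℂ_[p])‖ < 1) ∧
                        (‖((coeff m' P' : unrIntegers p) : ℂ_[p])‖ = 1 ∧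
                          ∀ i < m', ‖((coeff i P' : unrIntegers p) : ℂ_[p])‖ < 1) ∧
                        IsUnit u ∧
                        (∀ i, ‖((coeff i (u * (L' * P')) : unrIntegers p) : ℂ_[p]) -
                          ((coeff i (L * P) : unrIntegers p) : ℂ_[p])‖ < 1) ∧
                        ((∃ a, (‖((coeff a (PowerSeries.map (toUnr p) g * P) : unrIntegers p) : ℂ_[p])‖ = 1 ∧
                            ∀ i < a, ‖((coeff i (PowerSeries.map (toUnr p) g * P) : unrIntegers p) :
                              ℂ_[p])‖ < 1)) →
                          ∃ a', (‖((coeff a' (PowerSeries.map (toUnr p) g' * P') : unrIntegers p) : ℂ_[p])‖ = 1 ∧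
                            ∀ i < a', ‖((coeff i (PowerSeries.map (toUnr p) g' * P') : unrIntegers p) :
                              ℂ_[p])‖ < 1)) ∧
                        (∀ a a', (‖((coeff a (PowerSeries.map (toUnr p) g * P) : unrIntegers p) : ℂ_[p])‖ = 1 ∧
                            ∀ i < a, ‖((coeff i (PowerSeries.map (toUnr p) g * P) : unrIntegers p) :
                              ℂ_[p])‖ < 1) →
                          (‖((coeff a' (PowerSeries.map (toUnr p) g' * P') : unrIntegers p) : ℂ_[p])‖ = 1 ∧
                            ∀ i < a', ‖((coeff i (PowerSeries.map (toUnr p) g' * P') : unrIntegers p) :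
                              ℂ_[p])‖ < 1) → a = a'))
    (hX : ClassX11b W p) (hp5 : 5 ≤ p) (hsurj : Surj W p) :
    Typed.MissingLowerBoundAt W p :=
  missingLowerBoundAt_of_imcDivSomeFrameB_guarded_of_pNew hGZ hKo hWu hGZK hmod hnf hMaz hHL hPT hEP hB
    (P2.imcDivSomeFrameB_guarded_of_thm124b_of_unrFrame_of_upperDivisibility_of_transfer h124 h422
      (P2.unrFrame_of_hsieh2014_unrPeriod_of_bdp2013 hH hR) hUB hTR) hX hp5 hsurj

end Summit.BirchSwinnertonDyer.BirchSwinnertonDyer.Theorems.Rest3GuardedB12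

end
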